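import Mathlib
import Summits.Ventures.DiscreteObjects.Mahler.PisotLowerBound

/-!
# Siegel's theorem: `θ₀ = 1.3247…` is the smallest Pisot number (venture `DiscreteObjects`, target L)

Cell `pub-namedobj`, seat `pub-namedobj-mahler` (gen 8). Framing: lottery ticket; floor = certified
bounds/negative ranges.

[Siegel 1944; McKee–Smyth, *Around the Unit Circle*, §12.3.]  Completing `PisotLowerBound`: the real root
`θ₀` of `z³ = z + 1` is itself a Pisot number — `X³ - X - 1` is irreducible over `ℤ`
(`irreducible_X_cube_sub_X_sub_one`, no integer root) and its two other roots `ζ, ζ̄` have modulus `< 1`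
(`SmythConstant.X_cube_sub_X_sub_one_eq_prod`) — so that `θ₀` is the LEAST element of the set of Pisot
numbers (`isLeast_pisot_smythTheta`), Pisot numbers being phrased on minimal polynomials as in
`PisotLowerBound`: `θ > 1` real, a root of a monic irreducible `P ∈ ℤ[X]` all of whose other complex
roots have modulus `< 1`.
-/

namespace Summit.Ventures.DiscreteObjects.Mahler

open Polynomial
open scoped ComplexConjugate

/-- `X³ - X - 1` is irreducible in `ℤ[X]` (a cubic without integer roots). -/
theorem irreducible_X_cube_sub_X_sub_one : Irreducible (X ^ 3 - X - 1 : ℤ[X]) := by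
  have hmonic : (X ^ 3 - X - 1 : ℤ[X]).Monic := by monicity!
  have hdeg : (X ^ 3 - X - 1 : ℤ[X]).natDegree = 3 := by compute_degree!
  rw [hmonic.irreducible_iff_roots_eq_zero_of_degree_le_three (by rw [hdeg]; norm_num) (by rw [hdeg]),
    Multiset.eq_zero_iff_forall_notMem]
  intro n hn
  rw [mem_roots hmonic.ne_zero, IsRoot.def] at hn
  simp only [eval_sub, eval_pow, eval_X, eval_one] at hn
  -- `n (n² - 1) = 1` forces `n = ±1`, neither of which is a root
  have h1 : n * (n ^ 2 - 1) = 1 := by linear_combination hn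
  have hu : IsUnit n := isUnit_of_dvd_one ⟨n ^ 2 - 1, h1.symm⟩
  rcases Int.isUnit_iff.mp hu with h | h <;> rw [h] at hn <;> norm_num at hn

/-- The set of **Pisot numbers**, phrased on minimal polynomials: real `θ > 1` that is a root of a monic
irreducible `P ∈ ℤ[X]` all of whose other complex roots lie in the open unit disc.  (Stated as a set
comprehension inside the theorems below; no new definition is introduced.) -/
theorem smythTheta_mem_pisot :
    ∃ P : ℤ[X], P.Monic ∧ Irreducible P ∧ 1 < smythTheta ∧
      ((smythTheta : ℂ)) ∈ (P.map (Int.castRingHom ℂ)).roots ∧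
      ∀ α ∈ (P.map (Int.castRingHom ℂ)).roots, α ≠ (smythTheta : ℂ) → ‖α‖ < 1 := by
  obtain ⟨ζ, hζ, hfac⟩ := X_cube_sub_X_sub_one_eq_prod
  have hmap : (X ^ 3 - X - 1 : ℤ[X]).map (Int.castRingHom ℂ) = (X ^ 3 - X - 1 : ℂ[X]) := by
    simp [Polynomial.map_sub, Polynomial.map_pow]
  have hne : (X ^ 3 - X - 1 : ℂ[X]) ≠ 0 := by
    intro h
    have := congrArg natDegree h
    rw [show (X ^ 3 - X - 1 : ℂ[X]).natDegree = 3 by compute_degree!, natDegree_zero] at this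
    exact absurd this (by norm_num)
  have hmem : ∀ α : ℂ, α ∈ ((X ^ 3 - X - 1 : ℤ[X]).map (Int.castRingHom ℂ)).roots ↔
      (α = smythTheta ∨ α = ζ) ∨ α = conj ζ := by
    intro α
    rw [hmap, mem_roots hne, IsRoot.def, hfac]
    simp only [eval_mul, eval_sub, eval_X, eval_C, mul_eq_zero, sub_eq_zero]
  refine ⟨X ^ 3 - X - 1, by monicity!, irreducible_X_cube_sub_X_sub_one,
    lt_trans (by norm_num) smythTheta_gt, (hmem _).mpr (Or.inl (Or.inl rfl)), ?_⟩
  intro α hα hαne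
  rcases (hmem α).mp hα with (h | h) | h
  · exact absurd h hαne
  · rw [h]; exact hζ
  · rw [h, Complex.norm_conj]; exact hζ

/-- **Siegel's theorem (1944): `θ₀ = 1.3247…` is the smallest Pisot number** [McKee–Smyth §12.3].
With Pisot numbers phrased on minimal polynomials (monic irreducible `P ∈ ℤ[X]`, a real root `θ > 1`,
all other complex roots of modulus `< 1`), `θ₀` — the real root of `z³ = z + 1` — is the least one. -/
theorem isLeast_pisot_smythTheta :
    IsLeast {θ : ℝ | ∃ P : ℤ[X], P.Monic ∧ Irreducible P ∧ 1 < θ ∧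
      ((θ : ℂ)) ∈ (P.map (Int.castRingHom ℂ)).roots ∧
      ∀ α ∈ (P.map (Int.castRingHom ℂ)).roots, α ≠ (θ : ℂ) → ‖α‖ < 1} smythTheta := by
  refine ⟨smythTheta_mem_pisot, ?_⟩
  rintro θ ⟨P, hmonic, hirr, hθ1, hroot, hothers⟩
  exact smythTheta_le_of_pisot hmonic hirr hθ1 hroot hothers

end Summit.Ventures.DiscreteObjects.Mahler
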